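import Literature.AlgebraicGeometry.Motives.HodgeThetaSubalgebraUnitaryFifteenSixteenReduction
import Literature.AlgebraicGeometry.Motives.HodgeThetaSubalgebraUnitaryRaisingSpaceSpan
import HarnessLib

/-!
# The `Θ`-subalgebra theorem for unitary multiplicities `(15, 16)`: no maximal raising rank `12` — the `p = 31` cell
# `{15, 16}` reduces to a maximal raising rank `10` (Ribet 1983 Thm. 3, Lie step); TOOL D for type `(3 | b)`

Family `hodge`, layer `Literature/AlgebraicGeometry/Motives` (pure linear algebra over `ℂ`; no geometry). Research
context: cell `pub-hodge-ring2` (HONEST FRAMING: research route conditional on HC_CM; not a corollary; Q11.4-sentence-2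
already refuted in dim ≥ 3), Literature lane gen 87, programme R75. UNCONDITIONAL; theorems only, no definition, no
named fact (D-0026), no `sorry`. HONEST SCOPE: a step of the open `(15 | 16)` core, not the core. By
`HodgeThetaSubalgebraUnitaryFifteenSixteenReduction` a proper irreducible unitary `Θ`-subalgebra of type `(15 | 16)`
has maximal raising rank `10` or `12` and raising ranks in `{0, 4, 6, 8, 10, 12}`; THIS FILE kills the maximal rank
`12`, so such an algebra has maximal raising rank exactly `10` and ranks in `{0, 4, 6, 8, 10}`.

* §1 TOOL D (**`UnitaryThree.no_rank_two_of_no_rank_one`**): in an irreducible unitary algebra of type `(3 | b)`,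
  `b ≥ 5`, without rank-one raising operators there is no rank-two raising operator. At a rank-`2` raising `A`
  (adjoint `C`; Levi types `(1 | 2)` and `(2 | b − 2)`; `U⁻ ⊥ U⁺`): `j = 1` would make `L⁻` full
  (`UnitaryRankOneRaise.eq_top_of_rankOne_raise_two`) on the larger side; for a raising `X` commuting with `ι` the
  raising operator `XCX ∈ 𝔊` takes its values in the line `P ∩ U⁺`, so vanishes; if `rk X|_{U⁻} = 2` then
  `X(U⁻) = A(W)` and `C(A(W)) = Q ∩ U⁺`, so `X` kills `U⁺`; hence every raising `X` commuting with `ι` kills `U⁺`,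
  against `UnitaryLeviFull.exists_raise_commute_apply_ne_zero`.
* §2 (**`UnitaryFifteenSixteen.no_maxRank_twelve`**). At a raising `B` of maximal rank `12` the Levi types are
  `(3 | 12)` (`L⁺`) and `(12 | 4)` (`L⁻`); `i = 1` is killed by the maximality polarisation
  (`UnitaryLeviSetup.false_of_full_of_maxRank`), `j = 1` by the rank-one core on the larger side, `i = 2` by TOOL D on
  `L⁺`; with `i ≤ 3`, `j ≤ 4`, `i + j ∈ {0, 4, 6}` the profiles are `(0,0)`, `(0,4)`, `(3,3)`. `(0,4)` and `(3,3)`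
  do not coexist (two pencils give `(3,4)`, rank `7`); some `X₀` moves `U⁺`, so `(3,3)` occurs and `(0,4)` does
  not: `L⁺` is a `(3 | 12)` algebra of constant raising rank `3` — spanned by `4` raising elements
  (`UnitaryConstantRank.exists_fin_span_raise`) — and `L⁻` an irreducible `(12 | 4)` algebra with raising ranks in
  `{0, 3}` whose raising elements are spanned by the `4` transferred ones (`UnitaryLeviSetup.exists_fin_span_transfer`),
  contradicting `UnitaryConstantRank.exists_raise_not_mem_span_fin` (`12 = 4·3`, `4 ∉ {0, 3}`).
* §3 **`UnitaryFifteenSixteen.eq_top_of_smul_of_maxRank_ne_ten`**, **`exists_maxRank_ten_of_ne_top`**.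

WHAT REMAINS for the `(15 | 16)` core after this file: the maximal raising rank `10` (Levi types `(5 | 10)` and
`(10 | 6)`; kills `i, j ∉ {1, 3}`; profiles among `(0,4)`, `(0,6)`, `(2,2)`, `(2,4)`, `(2,6)`, `(4,0)`, `(4,2)`,
`(4,4)`, `(4,6)`, `(5,5)`; the constant profile `(5,5)` is already excluded by the raising-space dimension for
`k = 2`).

## References
* [Ribet1983] K. A. Ribet, *Hodge classes on certain types of abelian varieties*, Amer. J. Math. 105 (1983), Thm. 3.
* [Gordon1997] B. B. Gordon, *A survey of the Hodge conjecture for abelian varieties*, Thm. 6.3 (3), pp. 18–19.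
* [Deligne1982HodgeCycles] P. Deligne, *Hodge cycles on abelian varieties*, LNM 900 (1982), I §3 Prop. 3.4, 3.6.
* [GoodmanWallachGTM255] R. Goodman, N. R. Wallach, GTM 255 (2009), §4.1.1.
* [HoffmanKunze1971LinearAlgebra] K. Hoffman, R. Kunze, *Linear Algebra* (1971), §3.1 Thm. 2, §6.7, §8.3.
-/

noncomputable section

open Module

namespace Literature.AlgebraicGeometry.Motives

namespace HodgeStructure

universe u

variable {W : Type u} [AddCommGroup W] [Module ℂ W]

/-! ### §1 TOOL D: on type `(3 | b)`, `b ≥ 5`, a rank-two raising operator forces a rank-one raising operator -/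

/-- **TOOL D.** In an irreducible unitary `Θ`-subalgebra of type `(3 | b)`, `b ≥ 5`, without raising operators of
rank `1` there is no raising operator of rank `2`. At a rank-`2` raising `A` (adjoint `C`) the Levi types are
`(1 | 2)` (`L⁺` on `U⁺ = (P ∩ ker C) ⊕ C(P)`) and `(2 | b − 2)` (`L⁻`); `j = 1` is impossible (`L⁻` would be full,
`UnitaryRankOneRaise.eq_top_of_rankOne_raise_two`, on the larger side). For a raising `X` commuting with `ι` the
raising operator `XCX ∈ 𝔊` takes its values in the line `P ∩ U⁺`, so `XCX = 0`; if `rk X|_{U⁻} = 2` then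
`X(U⁻) = A(W)` and `C(A(W)) = Q ∩ U⁺`, so `X` kills `U⁺`. Hence every raising `X` commuting with `ι` kills `U⁺` —
against `UnitaryLeviFull.exists_raise_commute_apply_ne_zero`. (`U⁻ ⊥ U⁺` for `s`, which places `C(P ∩ U⁺) = 0` and
`C(A(W)) ⊆ U⁺`.) [cite: Ribet1983, Thm. 3] [cite: Gordon1997, §6 (proof of Thm. 6.3.3)]
[cite: Deligne1982HodgeCycles, I §3 Prop. 3.4, 3.6] [cite: GoodmanWallachGTM255, §4.1.1] -/
theorem UnitaryThree.no_rank_two_of_no_rank_one [FiniteDimensional ℂ W] {𝔊 : Submodule ℂ (Module.End ℂ W)}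
    (hbr : ∀ Y ∈ 𝔊, ∀ Z ∈ 𝔊, Y * Z - Z * Y ∈ 𝔊)
    (hirr : ∀ U : Submodule ℂ W, (∀ A ∈ 𝔊, ∀ u ∈ U, A u ∈ U) → U = ⊥ ∨ U = ⊤)
    {Θ : Module.End ℂ W} (hΘ : Θ ∈ 𝔊) (hΘΘ : Θ * Θ = 1)
    {P Q : Submodule ℂ W} (hP : ∀ x, x ∈ P ↔ Θ x = x) (hQ : ∀ x, x ∈ Q ↔ Θ x = -x)
    (hP3 : Module.finrank ℂ P = 3) (hQ5 : 5 ≤ Module.finrank ℂ Q)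
    {s : W → W → ℂ} (hadd : ∀ x y z, s (x + y) z = s x z + s y z) (hsymm : ∀ x y, s y x = starRingEnd ℂ (s x y))
    (hPQ : ∀ p ∈ P, ∀ q ∈ Q, s p q = 0) (hdefP : ∀ p ∈ P, s p p = 0 → p = 0) (hdefQ : ∀ q ∈ Q, s q q = 0 → q = 0)
    (hadj : ∀ X ∈ 𝔊, ∃ Y ∈ 𝔊, ∀ x y, s (X x) y = s x (Y y))
    (hno1 : ∀ B' ∈ 𝔊, Θ * B' = B' → B' * Θ = -B' → Module.finrank ℂ (LinearMap.range B') ≠ 1)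
    {A : Module.End ℂ W} (hA : A ∈ 𝔊) (hΘA : Θ * A = A) (hAΘ : A * Θ = -A)
    (h2 : Module.finrank ℂ (LinearMap.range A) = 2) : False := by
  classical
  obtain ⟨-, h0r, -, -, hnegl, -, hsubl⟩ := UnitaryTwoOdd.herm_right hadd hsymm
  have hΘΘv : ∀ v, Θ (Θ v) = v := fun v => by rw [← Module.End.mul_apply, hΘΘ, Module.End.one_apply]
  have hsU : ∀ U : Submodule ℂ W, ∀ x y z : U, s ((x + y : U) : W) z = s (x : W) z + s (y : W) z :=
    fun U x y z => by simp only [Submodule.coe_add, hadd]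
  have hraiseP : ∀ Z : Module.End ℂ W, Z * Θ = -Z → ∀ p, Θ p = p → Z p = 0 := fun Z hZΘ p hp => by
    have h : Z p = -(Z p) := by
      conv_lhs => rw [← hp, ← Module.End.mul_apply, hZΘ, LinearMap.neg_apply]
    have h2 : (2 : ℂ) • Z p = 0 := by rw [two_smul]; nth_rewrite 2 [h]; rw [add_neg_cancel]
    exact (smul_eq_zero.1 h2).resolve_left two_ne_zero
  obtain ⟨ι, Um, Up, PU, QU, Lm, ιm, Pm, Qm, Lp, ιp, Pp, Qp, hιmem, hιι, hιΘ, hιs, hUm, hUp, hfinUm, hfinUp,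
    hPM, hQM, hPU, hQU, hrangeP, hPUP, hQUQ, hfinQM, hfinPU, hfinQU, hLm, hLp,
    hιmapply, hPmmem, hQmmem, hbrLm, hirrLm, hιmmem, hιmιm, hPm, hQm, hfinPm, hfinQm, hPmQm, hdefPm, hdefQm, hadjLm,
    hιpapply, hPpmem, hQpmem, hbrLp, hirrLp, hιpmem, hιpιp, hPp, hQp, hfinPp, hfinQp, hPpQp, hdefPp, hdefQp, hadjLp,
    hsplit⟩ :=
    UnitaryLeviSetup.exists_levi_pair hbr hirr hΘ hΘΘ hP hQ hadd hsymm hPQ hdefP hdefQ hadj hA hΘA hAΘ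
  rw [h2] at hfinQM hfinPU hfinQU hfinPm hfinQm hfinPp hfinQp hsplit
  rw [hP3] at hfinPU hfinPp hfinUp
  have hιιv : ∀ v, ι (ι v) = v := fun v => by rw [← Module.End.mul_apply, hιι, Module.End.one_apply]
  have hΘι : ∀ v, Θ (ι v) = ι (Θ v) := fun v => by rw [← Module.End.mul_apply, ← hιΘ, Module.End.mul_apply]
  have hcm : ∀ Z : Module.End ℂ W, Z * ι = ι * Z → ∀ x ∈ Um, Z x ∈ Um := fun Z hZ x hx =>
    (hUm _).2 (by rw [← Module.End.mul_apply, ← hZ, Module.End.mul_apply, (hUm x).1 hx, map_neg])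
  have hfullm_of : Lm = ⊤ → False := fun h =>
    UnitaryLeviSetup.false_of_full_larger hbr hΘΘ hno1 hιι hιΘ hUm hUp (by omega) (by omega) hPM hQM (by omega)
      (by omega) hLm h
  -- the adjoint `C` of `A`; `U⁻ ⊥ U⁺`
  obtain ⟨C, hC, hAC⟩ := hadj A hA
  obtain ⟨hΘC, -⟩ := UnitaryTwoOdd.lower_of_adjoint hadd hsymm hΘΘ hP hQ hPQ hdefP hdefQ hΘA hAΘ hAC
  have hCQ : ∀ w, Θ (C w) = -(C w) := fun w => by rw [← Module.End.mul_apply, hΘC, LinearMap.neg_apply]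
  have hperp : ∀ u v, ι u = -u → ι v = v → s u v = 0 := fun u v hu hv => by
    have h : s u v = -s u v := by
      conv_lhs => rw [← hv, ← hιs, hu, hnegl]
    have h2 : (2 : ℂ) * s u v = 0 := by rw [two_mul]; nth_rewrite 2 [h]; rw [add_neg_cancel]
    exact (mul_eq_zero.1 h2).resolve_left two_ne_zero
  have hperp' : ∀ v u, ι v = v → ι u = -u → s v u = 0 := fun v u hv hu => by
    rw [hsymm, hperp u v hu hv, map_zero]
  -- `C` kills `P ∩ U⁺`
  have hCPU : ∀ v, ι v = v → Θ v = v → C v = 0 := fun v hv hΘv => by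
    refine hdefQ _ ((hQ _).2 (hCQ v)) ?_
    rw [← hAC, hperp _ _ ((hPM _).1 (LinearMap.mem_range_self A _)).1 hv]
  -- `C` maps `A(W)` into `Q ∩ U⁺`
  have hCim : ∀ p ∈ LinearMap.range A, ι (C p) = C p := fun p hp => by
    set b := (2 : ℂ)⁻¹ • (C p - ι (C p)) with hb
    have hιb : ι b = -b := by rw [hb, map_smul, map_sub, hιιv, ← smul_neg, neg_sub]
    have hΘb : Θ b = -b := by rw [hb, map_smul, map_sub, hΘι, hCQ, map_neg, ← smul_neg, neg_sub, sub_neg_eq_add,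
      neg_add_eq_sub]
    have hbD := (hQM b).2 ⟨hιb, hΘb⟩
    have hAb : A b = 0 := LinearMap.mem_ker.1 (Submodule.mem_inf.1 hbD).2
    have hιa : ι (C p - b) = C p - b := by
      have : C p - b = (2 : ℂ)⁻¹ • (C p + ι (C p)) := by rw [hb]; module
      rw [this, map_smul, map_add, hιιv, add_comm]
    have hsbb : s b b = 0 := by
      have h1 : s (C p) b = 0 := by rw [hsymm, ← hAC, hAb]; simp only [map_eq_zero]; exact (UnitaryTwoOdd.herm_right hadd hsymm).2.2.1 p
      have h3 : s (C p - b) b = 0 := hperp' _ _ hιa hιb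
      rw [hsubl, h1, zero_sub, neg_eq_zero] at h3
      exact h3
    have hb0 : b = 0 := hdefQ b ((hQ b).2 hΘb) hsbb
    have : C p = (C p - b) + b := by rw [sub_add_cancel]
    rw [this, hb0, add_zero, ← hb0]
    exact hb0.symm ▸ hιa
  -- `j = 1` is impossible
  have hkillm1 : ∀ X ∈ 𝔊, Θ * X = X → X * Θ = -X → X * ι = ι * X → Module.finrank ℂ (Um.map X) ≠ 1 := by
    intro X hX hΘX hXΘ hXc h1
    obtain ⟨hxmem, hιmx, hxιm, hxrk⟩ := UnitaryLeviSetup.restrict_mem hcm hLm hιmapply X hX hΘX hXΘ hXc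
    rw [h1] at hxrk
    exact hfullm_of (UnitaryRankOneRaise.eq_top_of_rankOne_raise_two hbrLm hirrLm hιmmem hιmιm hPm hQm
      (s := fun v w : Um => s (v : W) w) (hsU Um) (fun v w => hsymm v w) hPmQm hdefPm hdefQm hadjLm hxmem hιmx hxιm
      hxrk hfinPm (by omega))
  -- the main step: a raising `X` commuting with `ι` with `rk X|_{U⁻} = 2` kills `U⁺`
  have hmain : ∀ X ∈ 𝔊, Θ * X = X → X * Θ = -X → X * ι = ι * X → Module.finrank ℂ (Um.map X) = 2 →
      ∀ v, ι v = v → X v = 0 := by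
    intro X hX hΘX hXΘ hXc hj2 v hv
    -- `T = XCX ∈ 𝔊` is raising with values in the line `P ∩ U⁺`, hence zero
    have hT2 := UnitaryRaisingSpace.bracket_bracket_mem hbr hX hC hX hΘX hXΘ hΘX hXΘ
    have hTmem : X * C * X ∈ 𝔊 := by
      have h := Submodule.smul_mem 𝔊 ((2 : ℂ)⁻¹) hT2
      rwa [← two_smul ℂ, smul_smul, inv_mul_cancel₀ (two_ne_zero (α := ℂ)), one_smul] at h
    have hΘT : Θ * (X * C * X) = X * C * X := by rw [← mul_assoc, ← mul_assoc, hΘX]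
    have hTΘ : X * C * X * Θ = -(X * C * X) := by rw [mul_assoc, hXΘ, mul_neg]
    have hTval : ∀ w, X (C (X w)) ∈ PU := fun w => by
      set y := X w with hy
      have hΘy : Θ y = y := by rw [hy, ← Module.End.mul_apply, hΘX]
      set p₁ := (2 : ℂ)⁻¹ • (y - ι y) with hp₁
      set p₀ := (2 : ℂ)⁻¹ • (y + ι y) with hp₀
      have hιp₁ : ι p₁ = -p₁ := by rw [hp₁, map_smul, map_sub, hιιv, ← smul_neg, neg_sub]
      have hΘp₁ : Θ p₁ = p₁ := by rw [hp₁, map_smul, map_sub, hΘι, hΘy]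
      have hιp₀ : ι p₀ = p₀ := by rw [hp₀, map_smul, map_add, hιιv, add_comm]
      have hΘp₀ : Θ p₀ = p₀ := by rw [hp₀, map_smul, map_add, hΘι, hΘy]
      have hyd : y = p₁ + p₀ := by rw [hp₁, hp₀]; module
      have hp₁A : p₁ ∈ LinearMap.range A := (hPM _).2 ⟨hιp₁, hΘp₁⟩
      rw [hyd, map_add, map_add, hCPU p₀ hιp₀ hΘp₀, map_zero, add_zero]
      refine (hPU _).2 ⟨?_, by rw [← Module.End.mul_apply, hΘX]⟩
      rw [← Module.End.mul_apply, ← hXc, Module.End.mul_apply, hCim p₁ hp₁A]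
    have hT0 : X * C * X = 0 := by
      have hle : Module.finrank ℂ (LinearMap.range (X * C * X)) ≤ 1 := by
        rw [← show Module.finrank ℂ PU = 1 by omega]
        exact Submodule.finrank_mono (by rintro _ ⟨w, rfl⟩; exact hTval w)
      have hne := hno1 _ hTmem hΘT hTΘ
      have h0 : Module.finrank ℂ (LinearMap.range (X * C * X)) = 0 := by omega
      exact LinearMap.range_eq_bot.1 (Submodule.finrank_eq_zero.1 h0)
    -- `X(U⁻) = A(W)` and `C(A(W)) = Q ∩ U⁺`
    have hmapX : Um.map X = LinearMap.range A := by
      refine Submodule.eq_of_le_of_finrank_eq ?_ (by rw [hj2, h2])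
      rintro _ ⟨u, hu, rfl⟩
      exact (hPM _).2 ⟨by rw [← Module.End.mul_apply, ← hXc, Module.End.mul_apply, (hUm u).1 hu, map_neg],
        by rw [← Module.End.mul_apply, hΘX]⟩
    have hCinj : ∀ p ∈ LinearMap.range A, C p = 0 → p = 0 := by
      rintro _ ⟨w, rfl⟩ hCp
      exact hdefP _ (hrangeP (LinearMap.mem_range_self A w)) (by rw [hAC, hCp, h0r])
    have hmapC : (LinearMap.range A).map C = QU := by
      refine Submodule.eq_of_le_of_finrank_eq ?_ ?_
      · rintro _ ⟨p, hp, rfl⟩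
        exact (hQU _).2 ⟨hCim p hp, hCQ p⟩
      · have hker : LinearMap.ker (C.domRestrict (LinearMap.range A)) = ⊥ := by
          rw [LinearMap.ker_eq_bot']
          intro p hp
          exact Subtype.ext (hCinj p p.2 hp)
        have hrk := LinearMap.finrank_range_add_finrank_ker (C.domRestrict (LinearMap.range A))
        rw [LinearMap.range_domRestrict, hker, finrank_bot, add_zero, h2] at hrk
        rw [hrk, hfinQU]
    -- decompose `v ∈ U⁺` along `Θ`
    have hvd : v = (2 : ℂ)⁻¹ • (v + Θ v) + (2 : ℂ)⁻¹ • (v - Θ v) := by module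
    have hvP : Θ ((2 : ℂ)⁻¹ • (v + Θ v)) = (2 : ℂ)⁻¹ • (v + Θ v) := by rw [map_smul, map_add, hΘΘv, add_comm]
    have hvQ : (2 : ℂ)⁻¹ • (v - Θ v) ∈ QU := (hQU _).2 ⟨by rw [map_smul, map_sub, ← hΘι, hv], by
      rw [map_smul, map_sub, hΘΘv, ← smul_neg, neg_sub]⟩
    rw [← hmapC] at hvQ
    obtain ⟨p, hp, hpeq⟩ := hvQ
    rw [← hmapX] at hp
    obtain ⟨u, -, rfl⟩ := hp
    rw [hvd, map_add, hraiseP X hXΘ _ hvP, zero_add, ← hpeq]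
    have h := congrArg (fun T : Module.End ℂ W => T u) hT0
    simpa only [Module.End.mul_apply, LinearMap.zero_apply] using h
  -- conclusion: some raising `X₀` commuting with `ι` moves `U⁺`
  obtain ⟨⟨p, hp⟩, hp0⟩ := Module.finrank_pos_iff_exists_ne_zero.1 (show 0 < Module.finrank ℂ PU by omega)
  obtain ⟨⟨q, hq⟩, hq0⟩ := Module.finrank_pos_iff_exists_ne_zero.1 (show 0 < Module.finrank ℂ QU by omega)
  obtain ⟨X₀, hX₀, hΘX₀, hX₀Θ, hX₀c, c, hιc, hΘc, hX₀c0⟩ :=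
    UnitaryLeviFull.exists_raise_commute_apply_ne_zero hbr hirr hΘ hΘΘ hQ hιmem hιι hιΘ hUm hUp
      ⟨p, fun h => hp0 (Subtype.ext h), ((hPU p).1 hp).1, ((hPU p).1 hp).2⟩
      ⟨q, fun h => hq0 (Subtype.ext h), ((hQU q).1 hq).1, ((hQU q).1 hq).2⟩
  obtain ⟨hs, hi, hi', hj, hj'⟩ := hsplit X₀ hΘX₀ hX₀Θ hX₀c
  have h1 := hno1 X₀ hX₀ hΘX₀ hX₀Θ
  have hm1 := hkillm1 X₀ hX₀ hΘX₀ hX₀Θ hX₀c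
  rw [hs] at h1
  by_cases hj2 : Module.finrank ℂ (Um.map X₀) = 2
  · exact hX₀c0 (hmain X₀ hX₀ hΘX₀ hX₀Θ hX₀c hj2 c hιc)
  · have hi0 : Module.finrank ℂ (Up.map X₀) = 0 := by omega
    have hmem : X₀ c ∈ Up.map X₀ := Submodule.mem_map_of_mem ((hUp c).2 hιc)
    rw [Submodule.finrank_eq_zero.1 hi0, Submodule.mem_bot] at hmem
    exact hX₀c0 hmem

/-! ### §2 The maximal raising rank is not `12` -/

/-- (G6) **At `(15, 16)` with ranks in `{0, 4, 6, …, 12}`, a raising operator of MAXIMAL rank does not have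
rank `12`.** At such a `B` the Levi types are `(3 | 12)` (`L⁺`) and `(12 | 4)` (`L⁻`); `i = 1` is killed by the
maximality polarisation, `j = 1` by the rank-one core on the larger side, and `i = 2` by TOOL D (§1) applied to `L⁺`
(which has no rank-one raising element). With `i ≤ 3`, `j ≤ 4` the profiles are `(0,0)`, `(0,4)`, `(3,3)`; they do
not mix (two pencils give `(3,4)`, rank `7`); some `X₀` moves `U⁺`, so has profile `(3,3)`, hence `(0,4)` is absent:
`L⁺` is a `(3 | 12)` algebra of constant raising rank `3` — spanned by `4` raising elements
(`UnitaryConstantRank.exists_fin_span_raise`) — and `L⁻` an irreducible `(12 | 4)` algebra with raising ranks in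
`{0, 3}` whose raising elements are spanned by the `4` transferred ones (`UnitaryLeviSetup.exists_fin_span_transfer`),
contradicting `UnitaryConstantRank.exists_raise_not_mem_span_fin`. [cite: Ribet1983, Thm. 3]
[cite: Gordon1997, Thm. 6.3 (3)] [cite: Deligne1982HodgeCycles, I §3 Prop. 3.4, 3.6] [cite: GoodmanWallachGTM255, §4.1.1]
[cite: HoffmanKunze1971LinearAlgebra, §3.1 Thm. 2] -/
theorem UnitaryFifteenSixteen.no_maxRank_twelve [FiniteDimensional ℂ W] {𝔊 : Submodule ℂ (Module.End ℂ W)}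
    (hbr : ∀ Y ∈ 𝔊, ∀ Z ∈ 𝔊, Y * Z - Z * Y ∈ 𝔊)
    (hirr : ∀ U : Submodule ℂ W, (∀ A ∈ 𝔊, ∀ u ∈ U, A u ∈ U) → U = ⊥ ∨ U = ⊤)
    {Θ : Module.End ℂ W} (hΘ : Θ ∈ 𝔊) (hΘΘ : Θ * Θ = 1)
    {P Q : Submodule ℂ W} (hP : ∀ x, x ∈ P ↔ Θ x = x) (hQ : ∀ x, x ∈ Q ↔ Θ x = -x)
    (hP15 : Module.finrank ℂ P = 15) (hQ16 : Module.finrank ℂ Q = 16)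
    {s : W → W → ℂ} (hadd : ∀ x y z, s (x + y) z = s x z + s y z)
    (hsymm : ∀ x y, s y x = starRingEnd ℂ (s x y))
    (hPQ : ∀ p ∈ P, ∀ q ∈ Q, s p q = 0) (hdefP : ∀ p ∈ P, s p p = 0 → p = 0) (hdefQ : ∀ q ∈ Q, s q q = 0 → q = 0)
    (hadj : ∀ X ∈ 𝔊, ∃ Y ∈ 𝔊, ∀ x y, s (X x) y = s x (Y y))
    (hS : ∀ B' ∈ 𝔊, Θ * B' = B' → B' * Θ = -B' →
      Module.finrank ℂ (LinearMap.range B') = 0 ∨ Module.finrank ℂ (LinearMap.range B') = 4 ∨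
        Module.finrank ℂ (LinearMap.range B') = 6 ∨ Module.finrank ℂ (LinearMap.range B') = 8 ∨
        Module.finrank ℂ (LinearMap.range B') = 10 ∨ Module.finrank ℂ (LinearMap.range B') = 12)
    {B : Module.End ℂ W} (hB : B ∈ 𝔊) (hΘB : Θ * B = B) (hBΘ : B * Θ = -B)
    (hmax : ∀ B' ∈ 𝔊, Θ * B' = B' → B' * Θ = -B' →
      Module.finrank ℂ (LinearMap.range B') ≤ Module.finrank ℂ (LinearMap.range B))
                (hr : Module.finrank ℂ (LinearMap.range B) = 12) : False := by
  classical
  have hsU : ∀ U : Submodule ℂ W, ∀ x y z : U, s ((x + y : U) : W) z = s (x : W) z + s (y : W) z :=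
    fun U x y z => by simp only [Submodule.coe_add, hadd]
  have hno1 : ∀ B' ∈ 𝔊, Θ * B' = B' → B' * Θ = -B' → Module.finrank ℂ (LinearMap.range B') ≠ 1 := by
    intro B' hB' hΘB' hB'Θ h1
    rcases hS B' hB' hΘB' hB'Θ with h | h | h | h | h | h <;> omega
  obtain ⟨ι, Um, Up, PU, QU, Lm, ιm, Pm, Qm, Lp, ιp, Pp, Qp, hιmem, hιι, hιΘ, hιs, hUm, hUp, hfinUm, hfinUp,
    hPM, hQM, hPU, hQU, hrangeP, hPUP, hQUQ, hfinQM, hfinPU, hfinQU, hLm, hLp,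
    hιmapply, hPmmem, hQmmem, hbrLm, hirrLm, hιmmem, hιmιm, hPm, hQm, hfinPm, hfinQm, hPmQm, hdefPm, hdefQm, hadjLm,
    hιpapply, hPpmem, hQpmem, hbrLp, hirrLp, hιpmem, hιpιp, hPp, hQp, hfinPp, hfinQp, hPpQp, hdefPp, hdefQp, hadjLp,
    hsplit⟩ :=
    UnitaryLeviSetup.exists_levi_pair hbr hirr hΘ hΘΘ hP hQ hadd hsymm hPQ hdefP hdefQ hadj hB hΘB hBΘ
  rw [hr] at hfinQM hfinPU hfinQU hfinPm hfinQm hfinPp hfinQp hsplit hmax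
  rw [hQ16] at hfinQM hfinQm hfinUm
  rw [hP15] at hfinPU hfinPp hfinUp
  have hcm : ∀ Z : Module.End ℂ W, Z * ι = ι * Z → ∀ x ∈ Um, Z x ∈ Um := fun Z hZ x hx =>
    (hUm _).2 (by rw [← Module.End.mul_apply, ← hZ, Module.End.mul_apply, (hUm x).1 hx, map_neg])
  have hcp : ∀ Z : Module.End ℂ W, Z * ι = ι * Z → ∀ x ∈ Up, Z x ∈ Up := fun Z hZ x hx =>
    (hUp _).2 (by rw [← Module.End.mul_apply, ← hZ, Module.End.mul_apply, (hUp x).1 hx])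
  have hfullm_of : Lm = ⊤ → False := fun h =>
    UnitaryLeviSetup.false_of_full_larger hbr hΘΘ hno1 hιι hιΘ hUm hUp (by omega) (by omega) hPM hQM (by omega)
      (by omega) hLm h
  have hfullp_of : Lp = ⊤ → False := fun h =>
    UnitaryLeviSetup.false_of_full_of_maxRank hbr hΘ hΘΘ hQ hno1 hB hΘB hBΘ (by rw [hr]; exact hmax) hιι hιΘ hUp hPM
      hQM hPU hQU (by omega) (by omega) hLp h
  -- kill `i = 1` (`L⁺` of type `(3 | 12)`) and `j = 1` (`L⁻` of type `(12 | 4)`)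
  have hkillp1 : ∀ X ∈ 𝔊, Θ * X = X → X * Θ = -X → X * ι = ι * X → Module.finrank ℂ (Up.map X) ≠ 1 := by
    intro X hX hΘX hXΘ hXc h1
    obtain ⟨hymem, hιpy, hyιp, hyrk⟩ := UnitaryLeviSetup.restrict_mem hcp hLp hιpapply X hX hΘX hXΘ hXc
    rw [h1] at hyrk
    exact hfullp_of (UnitaryRankOneRaise.eq_top_of_rankOne_raise hbrLp hirrLp hιpmem hιpιp hPp hQp
      (s := fun v w : Up => s (v : W) w) (hsU Up) (fun v w => hsymm v w) hPpQp hdefPp hdefQp hadjLp hymem hιpy hyιp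
      hyrk (by omega) (by omega) (by omega))
  have hkillm1 : ∀ X ∈ 𝔊, Θ * X = X → X * Θ = -X → X * ι = ι * X → Module.finrank ℂ (Um.map X) ≠ 1 := by
    intro X hX hΘX hXΘ hXc h1
    obtain ⟨hxmem, hιmx, hxιm, hxrk⟩ := UnitaryLeviSetup.restrict_mem hcm hLm hιmapply X hX hΘX hXΘ hXc
    rw [h1] at hxrk
    exact hfullm_of (UnitaryRankOneRaise.eq_top_of_rankOne_raise hbrLm hirrLm hιmmem hιmιm hPm hQm
      (s := fun v w : Um => s (v : W) w) (hsU Um) (fun v w => hsymm v w) hPmQm hdefPm hdefQm hadjLm hxmem hιmx hxιm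
      hxrk (by omega) (by omega) (by omega))
  -- kill `i = 2`: TOOL D on `L⁺` (no rank-one raising element there)
  have hno1p : ∀ A ∈ Lp, ιp * A = A → A * ιp = -A → Module.finrank ℂ (LinearMap.range A) ≠ 1 := by
    intro A hA hιpA hAιp h1
    obtain ⟨X, hX, hΘX, hXΘ, hXc, hXUp⟩ := UnitaryLeviSetup.exists_lift hbr hΘ hΘΘ hcp hιΘ hLp hιpapply A hA hιpA hAιp
    exact hkillp1 X hX hΘX hXΘ hXc (by rw [hXUp, h1])
  have hkillp2 : ∀ X ∈ 𝔊, Θ * X = X → X * Θ = -X → X * ι = ι * X → Module.finrank ℂ (Up.map X) ≠ 2 := by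
    intro X hX hΘX hXΘ hXc hi2
    obtain ⟨hymem, hιpy, hyιp, hyrk⟩ := UnitaryLeviSetup.restrict_mem hcp hLp hιpapply X hX hΘX hXΘ hXc
    rw [hi2] at hyrk
    exact UnitaryThree.no_rank_two_of_no_rank_one hbrLp hirrLp hιpmem hιpιp hPp hQp (by omega) (by omega)
      (s := fun v w : Up => s (v : W) w) (hsU Up) (fun v w => hsymm v w) hPpQp hdefPp hdefQp hadjLp hno1p hymem hιpy
      hyιp hyrk
  -- the profiles are `(0, 0)`, `(0, 4)`, `(3, 3)`
  have hprof : ∀ X ∈ 𝔊, Θ * X = X → X * Θ = -X → X * ι = ι * X →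
      (Module.finrank ℂ (Up.map X) = 0 ∧ Module.finrank ℂ (Um.map X) = 0) ∨
        (Module.finrank ℂ (Up.map X) = 0 ∧ Module.finrank ℂ (Um.map X) = 4) ∨
        (Module.finrank ℂ (Up.map X) = 3 ∧ Module.finrank ℂ (Um.map X) = 3) := by
    intro X hX hΘX hXΘ hXc
    obtain ⟨hs, hi, hi', hj, hj'⟩ := hsplit X hΘX hXΘ hXc
    have h1 := hkillp1 X hX hΘX hXΘ hXc
    have h1' := hkillm1 X hX hΘX hXΘ hXc
    have h2' := hkillp2 X hX hΘX hXΘ hXc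
    have hr' := hS X hX hΘX hXΘ
    have hle := hmax X hX hΘX hXΘ
    rw [hs] at hr' hle
    omega
  -- `(0, 4)` and `(3, 3)` do not coexist (two pencils)
  have hnotboth : ∀ X ∈ 𝔊, Θ * X = X → X * Θ = -X → X * ι = ι * X → ∀ X' ∈ 𝔊, Θ * X' = X' → X' * Θ = -X' →
      X' * ι = ι * X' → Module.finrank ℂ (Um.map X) = 4 → Module.finrank ℂ (Up.map X') = 3 → False := by
    intro X hX hΘX hXΘ hXc X' hX' hΘX' hX'Θ hX'c h4 h3
    obtain ⟨c, hc1, hc2⟩ := UnitaryGenericRank.exists_finrank_le_and_finrank_le (X'.restrict (hcp X' hX'c))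
      (X.restrict (hcp X hXc)) (X.restrict (hcm X hXc)) (X'.restrict (hcm X' hX'c))
    obtain ⟨hX₁, hΘX₁, hX₁Θ, hX₁c⟩ := UnitaryLeviSetup.add_smul_raise X hX hΘX hXΘ hXc X' hX' hΘX' hX'Θ hX'c c
    have hi₁ := UnitaryLeviSetup.finrank_map_add_smul hcp X X' hXc hX'c c hX₁c
    have hj₁ := UnitaryLeviSetup.finrank_map_add_smul hcm X X' hXc hX'c c hX₁c
    have hy' : Module.finrank ℂ (LinearMap.range (X'.restrict (hcp X' hX'c))) = 3 := by
      rw [UnitaryLeviRank.finrank_range_restrict, h3]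
    have hx : Module.finrank ℂ (LinearMap.range (X.restrict (hcm X hXc))) = 4 := by
      rw [UnitaryLeviRank.finrank_range_restrict, h4]
    have hp := hprof (X + c • X') hX₁ hΘX₁ hX₁Θ hX₁c
    rw [hi₁, hj₁] at hp
    omega
  -- some `X₀` moves `U⁺`: profile `(3, 3)`
  obtain ⟨⟨p, hp⟩, hp0⟩ := Module.finrank_pos_iff_exists_ne_zero.1 (show 0 < Module.finrank ℂ PU by omega)
  obtain ⟨⟨q, hq⟩, hq0⟩ := Module.finrank_pos_iff_exists_ne_zero.1 (show 0 < Module.finrank ℂ QU by omega)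
  obtain ⟨X₀, hX₀, hΘX₀, hX₀Θ, hX₀c, c, hιc, hΘc, hX₀c0⟩ :=
    UnitaryLeviFull.exists_raise_commute_apply_ne_zero hbr hirr hΘ hΘΘ hQ hιmem hιι hιΘ hUm hUp
      ⟨p, fun h => hp0 (Subtype.ext h), ((hPU p).1 hp).1, ((hPU p).1 hp).2⟩
      ⟨q, fun h => hq0 (Subtype.ext h), ((hQU q).1 hq).1, ((hQU q).1 hq).2⟩
  have hi3 : Module.finrank ℂ (Up.map X₀) = 3 := by
    have hmem : X₀ c ∈ Up.map X₀ := Submodule.mem_map_of_mem ((hUp c).2 hιc)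
    rcases hprof X₀ hX₀ hΘX₀ hX₀Θ hX₀c with ⟨h0, -⟩ | ⟨h0, -⟩ | ⟨h3, -⟩
    · rw [Submodule.finrank_eq_zero.1 h0, Submodule.mem_bot] at hmem; exact absurd hmem hX₀c0
    · rw [Submodule.finrank_eq_zero.1 h0, Submodule.mem_bot] at hmem; exact absurd hmem hX₀c0
    · exact h3
  -- hence every profile is `(0,0)` or `(3,3)`: BOTH Levi algebras have constant raising rank `3`
  have hSp : ∀ A ∈ Lp, ιp * A = A → A * ιp = -A → A ≠ 0 → Module.finrank ℂ (LinearMap.range A) = 3 := by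
    intro A hA hιpA hAιp hAne
    obtain ⟨X, hX, hΘX, hXΘ, hXc, hXUp⟩ :=
      UnitaryLeviSetup.exists_lift hbr hΘ hΘΘ hcp hιΘ hLp hιpapply A hA hιpA hAιp
    have hA0 : Module.finrank ℂ (LinearMap.range A) ≠ 0 := fun h =>
      hAne (LinearMap.range_eq_bot.1 (Submodule.finrank_eq_zero.1 h))
    rcases hprof X hX hΘX hXΘ hXc with ⟨h, -⟩ | ⟨h, -⟩ | ⟨h, -⟩
    · exact (hA0 (hXUp ▸ h)).elim
    · exact (hA0 (hXUp ▸ h)).elim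
    · rw [← hXUp, h]
  have hSm : ∀ A ∈ Lm, ιm * A = A → A * ιm = -A →
      Module.finrank ℂ (LinearMap.range A) = 0 ∨ Module.finrank ℂ (LinearMap.range A) = 3 := by
    intro A hA hιmA hAιm
    obtain ⟨X, hX, hΘX, hXΘ, hXc, hXUm⟩ :=
      UnitaryLeviSetup.exists_lift hbr hΘ hΘΘ hcm hιΘ hLm hιmapply A hA hιmA hAιm
    rcases hprof X hX hΘX hXΘ hXc with ⟨-, h⟩ | ⟨-, h'⟩ | ⟨-, h⟩
    · exact Or.inl (hXUm ▸ h)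
    · exact (hnotboth X hX hΘX hXΘ hXc X₀ hX₀ hΘX₀ hX₀Θ hX₀c h' hi3).elim
    · exact Or.inr (hXUm ▸ h)
  -- a raising operator commuting with `ι` that vanishes on `U⁺` vanishes on `U⁻`
  have hrule : ∀ X ∈ 𝔊, Θ * X = X → X * Θ = -X → X * ι = ι * X → (∀ v ∈ Up, X v = 0) →
      ∀ u ∈ Um, X u = 0 := by
    intro X hX hΘX hXΘ hXc hXUp u hu
    have hi0 : Module.finrank ℂ (Up.map X) = 0 := by
      rw [Submodule.finrank_eq_zero, Submodule.eq_bot_iff]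
      rintro _ ⟨v, hv, rfl⟩
      exact hXUp v hv
    have hj0 : Module.finrank ℂ (Um.map X) = 0 := by
      rcases hprof X hX hΘX hXΘ hXc with ⟨-, h⟩ | ⟨-, h⟩ | ⟨h, -⟩
      · exact h
      · exact (hnotboth X hX hΘX hXΘ hXc X₀ hX₀ hΘX₀ hX₀Θ hX₀c h hi3).elim
      · omega
    have hmem : X u ∈ Um.map X := Submodule.mem_map_of_mem hu
    rwa [Submodule.finrank_eq_zero.1 hj0, Submodule.mem_bot] at hmem
  -- `L⁺` (type `(3 | 12)`): spanned by `4`; transfer; `L⁻` (type `(12 | 4)`, irreducible): never spanned by `4`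
  obtain ⟨F, hF, hspanF⟩ := UnitaryConstantRank.exists_fin_span_raise 4 hbrLp hirrLp hιpmem hιpιp hPp hQp (r := 3)
    (by norm_num) (by omega) (by omega) (hsU Up) (fun v w => hsymm v w) hPpQp hdefPp hdefQp hadjLp hSp
  obtain ⟨G, hG, hspanG⟩ := UnitaryLeviSetup.exists_fin_span_transfer hbr hΘ hΘΘ hιΘ hUm hUp hLp hLm hιpapply
    hιmapply hrule hF hspanF
  obtain ⟨A, hA, hιmA, hAιm, hAnot⟩ := UnitaryConstantRank.exists_raise_not_mem_span_fin hbrLm hirrLm hιmmem hιmιm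
    hPm hQm (r := 3) (k := 4) (by norm_num) (by norm_num) (by omega) (by omega) (by omega) hSm hG
  exact hAnot (hspanG A hA hιmA hAιm)

/-! ### §3 The `(15 | 16)` cell reduces to a maximal raising rank `10` -/

/-- **THE `(15 | 16)` REDUCTION, SHARPENED.** Under the hypotheses of
`UnitaryFifteenSixteen.eq_top_of_smul_of_maxRank`: if some raising operator of maximal rank has rank `≠ 10`, then
`𝔊 = End(W)`. [cite: Ribet1983, Thm. 3] [cite: Gordon1997, Thm. 6.3 (3)] [cite: Deligne1982HodgeCycles, I §3 Prop. 3.4, 3.6]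
[cite: GoodmanWallachGTM255, §4.1.1] -/
theorem UnitaryFifteenSixteen.eq_top_of_smul_of_maxRank_ne_ten [FiniteDimensional ℂ W]
    {𝔊 : Submodule ℂ (Module.End ℂ W)}
    (hbr : ∀ Y ∈ 𝔊, ∀ Z ∈ 𝔊, Y * Z - Z * Y ∈ 𝔊)
    (hirr : ∀ U : Submodule ℂ W, (∀ A ∈ 𝔊, ∀ u ∈ U, A u ∈ U) → U = ⊥ ∨ U = ⊤)
    {Θ : Module.End ℂ W} (hΘ : Θ ∈ 𝔊) (hΘΘ : Θ * Θ = 1)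
    {P Q : Submodule ℂ W} (hP : ∀ x, x ∈ P ↔ Θ x = x) (hQ : ∀ x, x ∈ Q ↔ Θ x = -x)
    (hP15 : Module.finrank ℂ P = 15) (hQ16 : Module.finrank ℂ Q = 16)
    {s : W → W → ℂ} (hadd : ∀ x y z, s (x + y) z = s x z + s y z)
    (hsmul : ∀ (c : ℂ) (x y : W), s (c • x) y = c * s x y) (hsymm : ∀ x y, s y x = starRingEnd ℂ (s x y))
    (hPQ : ∀ p ∈ P, ∀ q ∈ Q, s p q = 0) (hdefP : ∀ p ∈ P, s p p = 0 → p = 0) (hdefQ : ∀ q ∈ Q, s q q = 0 → q = 0)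
    (hadj : ∀ X ∈ 𝔊, ∃ Y ∈ 𝔊, ∀ x y, s (X x) y = s x (Y y))
    {B : Module.End ℂ W} (hB : B ∈ 𝔊) (hΘB : Θ * B = B) (hBΘ : B * Θ = -B)
    (hmax : ∀ B' ∈ 𝔊, Θ * B' = B' → B' * Θ = -B' →
      Module.finrank ℂ (LinearMap.range B') ≤ Module.finrank ℂ (LinearMap.range B))
    (h10 : Module.finrank ℂ (LinearMap.range B) ≠ 10) : 𝔊 = ⊤ := by
  by_contra hne
  obtain ⟨-, hranks⟩ := UnitaryFifteenSixteen.exists_maxRank_of_ne_top hbr hirr hΘ hΘΘ hP hQ hP15 hQ16 hadd hsmul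
    hsymm hPQ hdefP hdefQ hadj hne
  by_cases h12 : Module.finrank ℂ (LinearMap.range B) = 12
  · exact UnitaryFifteenSixteen.no_maxRank_twelve hbr hirr hΘ hΘΘ hP hQ hP15 hQ16 hadd hsymm hPQ hdefP hdefQ hadj
      hranks hB hΘB hBΘ hmax h12
  · exact hne (UnitaryFifteenSixteen.eq_top_of_smul_of_maxRank hbr hirr hΘ hΘΘ hP hQ hP15 hQ16 hadd hsmul hsymm hPQ
      hdefP hdefQ hadj hB hΘB hBΘ hmax h10 h12)

/-- **The residual configuration of the `(15 | 16)` cell, sharpened.** A PROPER `𝔊` (hypotheses of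
`eq_top_of_smul_of_maxRank`) has a raising operator of maximal rank exactly `10`, and all its raising ranks lie in
`{0, 4, 6, 8, 10}`. [cite: Ribet1983, Thm. 3] [cite: Gordon1997, Thm. 6.3 (3)] [cite: Deligne1982HodgeCycles, I §3 Prop. 3.4, 3.6] -/
theorem UnitaryFifteenSixteen.exists_maxRank_ten_of_ne_top [FiniteDimensional ℂ W] {𝔊 : Submodule ℂ (Module.End ℂ W)}
    (hbr : ∀ Y ∈ 𝔊, ∀ Z ∈ 𝔊, Y * Z - Z * Y ∈ 𝔊)
    (hirr : ∀ U : Submodule ℂ W, (∀ A ∈ 𝔊, ∀ u ∈ U, A u ∈ U) → U = ⊥ ∨ U = ⊤)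
    {Θ : Module.End ℂ W} (hΘ : Θ ∈ 𝔊) (hΘΘ : Θ * Θ = 1)
    {P Q : Submodule ℂ W} (hP : ∀ x, x ∈ P ↔ Θ x = x) (hQ : ∀ x, x ∈ Q ↔ Θ x = -x)
    (hP15 : Module.finrank ℂ P = 15) (hQ16 : Module.finrank ℂ Q = 16)
    {s : W → W → ℂ} (hadd : ∀ x y z, s (x + y) z = s x z + s y z)
    (hsmul : ∀ (c : ℂ) (x y : W), s (c • x) y = c * s x y) (hsymm : ∀ x y, s y x = starRingEnd ℂ (s x y))
    (hPQ : ∀ p ∈ P, ∀ q ∈ Q, s p q = 0) (hdefP : ∀ p ∈ P, s p p = 0 → p = 0) (hdefQ : ∀ q ∈ Q, s q q = 0 → q = 0)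
    (hadj : ∀ X ∈ 𝔊, ∃ Y ∈ 𝔊, ∀ x y, s (X x) y = s x (Y y)) (hne : 𝔊 ≠ ⊤) :
    (∃ B ∈ 𝔊, Θ * B = B ∧ B * Θ = -B ∧
      (∀ B' ∈ 𝔊, Θ * B' = B' → B' * Θ = -B' →
        Module.finrank ℂ (LinearMap.range B') ≤ Module.finrank ℂ (LinearMap.range B)) ∧
      Module.finrank ℂ (LinearMap.range B) = 10) ∧
    ∀ B' ∈ 𝔊, Θ * B' = B' → B' * Θ = -B' →
      Module.finrank ℂ (LinearMap.range B') = 0 ∨ Module.finrank ℂ (LinearMap.range B') = 4 ∨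
        Module.finrank ℂ (LinearMap.range B') = 6 ∨ Module.finrank ℂ (LinearMap.range B') = 8 ∨
        Module.finrank ℂ (LinearMap.range B') = 10 := by
  obtain ⟨⟨B, hB, hΘB, hBΘ, hmax, -⟩, hranks⟩ := UnitaryFifteenSixteen.exists_maxRank_of_ne_top hbr hirr hΘ hΘΘ hP
    hQ hP15 hQ16 hadd hsmul hsymm hPQ hdefP hdefQ hadj hne
  have h10 : Module.finrank ℂ (LinearMap.range B) = 10 := by
    by_contra h
    exact hne (UnitaryFifteenSixteen.eq_top_of_smul_of_maxRank_ne_ten hbr hirr hΘ hΘΘ hP hQ hP15 hQ16 hadd hsmul hsymm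
      hPQ hdefP hdefQ hadj hB hΘB hBΘ hmax h)
  refine ⟨⟨B, hB, hΘB, hBΘ, hmax, h10⟩, fun B' hB' hΘB' hB'Θ => ?_⟩
  have hle := hmax B' hB' hΘB' hB'Θ
  rcases hranks B' hB' hΘB' hB'Θ with h | h | h | h | h | h <;> omega

end HodgeStructure

end Literature.AlgebraicGeometry.Motives

end
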